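import Mathlib.NumberTheory.Modular
import Mathlib.Analysis.Asymptotics.Defs
import Mathlib.Analysis.Calculus.ContDiff.Defs
import Mathlib.Analysis.SpecialFunctions.Pow.Real
import Mathlib.MeasureTheory.Integral.IntervalIntegral.Basic
import HarnessLib

/-!
# Equidistribution of closed horocycles on the modular surface: the unconditional rate `O(y^{1/2})`

Family `rh`, trunk T-ANT. One named fact (D-0014, `def … : Prop`, no proof):
`Literature.NumberTheory.LFunctions.zagier_sarnak_horocycle_rate_half` — for every `F : ℂ → ℂ` which is `C^∞` on the open upper
half plane, `SL(2,ℤ)`-invariant, and vanishes high in the cusp of the standard fundamental domain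
(so `F` is smooth and compactly supported on `SL(2,ℤ)\ℍ`), the average of `F` over the closed
horocycle of height `y`, `m_F(y) = ∫₀¹ F(x + iy) dx`, satisfies `m_F(y) = c + O(y^{1/2})` as
`y → 0⁺` for some constant `c` (`= (3/π) ∫_{Γ\ℍ} F dμ`).

Sources. D. Zagier, *Eisenstein series and the Riemann zeta function*, in: Automorphic forms,
representation theory and arithmetic (Bombay 1979), Tata Inst. Stud. Math. 10, Springer 1981,
275–301 (Theorem on p. 277 and §§2–4: the Mellin transform of `m_F − c` is the Rankin–Selberg
transform `R*(F,s)/ξ(2s)`, whose poles in `0 < Re s < 1` are the `ρ/2`; unconditionally the error is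
`O(y^{1/2})`, and `O(y^{3/4−ε})` for all `F` is equivalent to RH); P. Sarnak, *Asymptotic behavior
of periodic orbits of the horocycle flow and Eisenstein series*, Comm. Pure Appl. Math. 34 (1981)
719–739, Thm. 1 (the same for closed horocycles of length `T = 1/y` on `SL(2,ℤ)\SL(2,ℝ)`,
error `O(T^{-1/2})`, and `O(T^{-3/4+ε})` iff RH).

Design. Test-function class exactly as in route RiemannHypothesis/Horocycle: smoothness only on
`{im > 0}` (a Γ-invariant cusp-supported `F` is discontinuous on `ℝ`), invariance under Mathlib's
`SL(2,ℤ)`-action on `UpperHalfPlane`, support cut off in `ModularGroup.fd`; compactly supported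
smooth functions on the modular surface are inside Zagier's rapid-decay class and Sarnak's
`C_c^∞`, so the printed theorems apply verbatim. `y ^ (1/2 : ℝ)` is `Real.rpow` (only `y > 0`
matters under `nhdsWithin 0 (Ioi 0)`). Mathlib has `UpperHalfPlane`, `ModularGroup.fd`,
`Asymptotics.IsBigO`; no Eisenstein series of weight 0 / Rankin–Selberg, hence a fact.
-/

noncomputable section

namespace Literature.NumberTheory.LFunctions

/-- **Zagier–Sarnak equidistribution rate for closed horocycles** (Zagier 1981, Thm p. 277;
Sarnak, CPAM 34 (1981), Thm 1): for `F : ℂ → ℂ` smooth on `{im > 0}`, `SL(2,ℤ)`-invariant and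
vanishing on `{z ∈ 𝒟 | im z > Y}` for some `Y`, there is `c : ℂ` with
`∫₀¹ F(x + iy) dx − c = O(y^{1/2})` as `y → 0⁺`. [cite: Sarnak1981, Thm 1] -/
def zagier_sarnak_horocycle_rate_half : Prop :=
  ∀ F : ℂ → ℂ, ContDiffOn ℝ (⊤ : ℕ∞) F {z : ℂ | 0 < z.im} →
    (∀ (g : Matrix.SpecialLinearGroup (Fin 2) ℤ) (z : UpperHalfPlane), F ↑(g • z) = F ↑z) →
    (∃ Y : ℝ, ∀ z : UpperHalfPlane, z ∈ ModularGroup.fd → Y < z.im → F ↑z = 0) →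
    ∃ c : ℂ, Asymptotics.IsBigO (nhdsWithin (0 : ℝ) (Set.Ioi 0))
      (fun y : ℝ => (∫ x in (0 : ℝ)..1, F (↑x + ↑y * Complex.I)) - c)
      (fun y : ℝ => y ^ ((1 / 2 : ℝ)))

end Literature.NumberTheory.LFunctions

end
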